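import Literature.Analysis.Pluripotential.WeightedLogPolynomialLevelSets
import HarnessLib

/-!
# Currents with algebraic analytic singularities `(c/d) dd^c log maxₖ |Fₖ|` on `ℙᴺ(ℂ)` and
Siu's theorem for them

Topic `Literature/Analysis/Pluripotential`. For non-zero homogeneous polynomials `F₁, …, F_K`
(`K ≥ 1`) of the same degree `d ≥ 1` in `N + 1` variables and `c ≥ 0`, the function
`V = (c/d) log maxₖ |Fₖ|` on `ℂ^{N+1}` is plurisubharmonic (a maximum of psh functions),
logarithmically homogeneous of degree `c` and `≢ -∞` near every point: the cone potential of a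
closed positive `(1,1)`-current of degree `c` on `ℙᴺ(ℂ)` with ALGEBRAIC ANALYTIC SINGULARITIES
along the common zero set `{F₁ = ⋯ = F_K = 0}` — which may have any codimension (for
`K = N`, `Fₖ = zₖ`, the singularity is the single point `[0 : ⋯ : 0 : 1]`). This file packages it
(`ClosedPositiveOneOneCurrent.ofHomogeneousPolynomialsMax`, a DEFINITION with body) and proves
**Siu's theorem for these currents** (`isAnalyticSet_lelongUpperLevelSet_ofHomogeneousPolynomialsMax`,
every `c' > 0`): by the chart reduction, `ν((c/d) maxₖ log |gₖ|, w) = (c/d) minₖ ord_w gₖ`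
(`lelongNumber_finset_sup'_log_enorm_eval`) and Siu's theorem for maxima of polynomial logarithms
on `ℂᴺ` (`isAnalyticSet_lelongUpperLevelSet_finset_sup'_log_enorm_eval`), so that
`E_{c'}(T) = {x | minₖ mult_x Fₖ ≥ c' d / c}` — level sets of codimension `≥ 2` in general,
beyond the divisorial examples of `HomogeneousPolynomialCurrent.lean` / `EffectiveDivisorCurrent.lean`.

## References

* [Siu1974] Y.-T. Siu, Analyticity of sets associated to Lelong numbers and the extension of
  closed positive currents, Invent. Math. 27 (1974): Main Theorem.
* L. Hörmander, Notions of Convexity (1994), Cor. 4.1.18, Thm. 4.3.3.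
* [HormanderSCV1973] L. Hörmander, An introduction to complex analysis in several variables
  (1973), Thm. 1.6.2, Cor. 1.6.6 and §2.6.
-/

noncomputable section

open scoped Topology ENNReal Manifold ContDiff LinearAlgebra.Projectivization
open MeasureTheory Filter Set Metric MvPolynomial

namespace Literature.Analysis.Pluripotential

namespace ClosedPositiveOneOneCurrent

variable {N K : ℕ}

/-- Adding a constant commutes with finite maxima in `[-∞, +∞]`. [folklore] -/
theorem sup'_const_add {ι : Type*} {s : Finset ι} (hs : s.Nonempty) (r : EReal) (L : ι → EReal) :
    (s.sup' hs fun i ↦ r + L i) = r + s.sup' hs L := by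
  refine le_antisymm (Finset.sup'_le _ _ fun i hi ↦ add_le_add_right (Finset.le_sup' L hi) _) ?_
  obtain ⟨i₀, hi₀, h⟩ := Finset.exists_mem_eq_sup' hs L
  rw [h]
  exact Finset.le_sup' (fun i ↦ r + L i) hi₀

/-- `log |F(a v)| = d log |a| + log |F(v)|` for `F` homogeneous of degree `d`, `a ≠ 0`.
[folklore] -/
theorem log_enorm_eval_smul {F : MvPolynomial (Fin (N + 1)) ℂ} {d : ℕ} (hF : F.IsHomogeneous d)
    {a : ℂ} (ha : a ≠ 0) (v : Fin (N + 1) → ℂ) :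
    ENNReal.log ‖eval (a • v) F‖ₑ = ((d * Real.log ‖a‖ : ℝ) : EReal) + ENNReal.log ‖eval v F‖ₑ := by
  rw [Projectivization.eval_smul_of_isHomogeneous hF, enorm_mul, ENNReal.log_mul_add, enorm_pow,
    ENNReal.log_pow, log_enorm_eq_coe ha, ← EReal.coe_coe_eq_natCast, ← EReal.coe_mul]

/-- Distributing `c/d` over `d log |a| + M` for `M ∈ [-∞, +∞)`. [folklore] -/
theorem const_mul_coe_add_of_ne_top {d : ℕ} (hd : 0 < d) {c : ℝ} (hc : 0 ≤ c) (r : ℝ) {M : EReal}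
    (hM : M ≠ ⊤) :
    ((c / d : ℝ) : EReal) * (((d * r : ℝ) : EReal) + M) =
      ((c / d : ℝ) : EReal) * M + ((c * r : ℝ) : EReal) := by
  have hd0 : (d : ℝ) ≠ 0 := by exact_mod_cast hd.ne'
  induction M using EReal.rec with
  | bot =>
    rw [EReal.add_bot]
    rcases hc.eq_or_lt with rfl | hc'
    · simp
    · have hcd : (0 : ℝ) < c / d := div_pos hc' (Nat.cast_pos.2 hd)
      rw [EReal.coe_mul_bot_of_pos hcd, EReal.bot_add]
  | coe m =>
    rw [← EReal.coe_add, ← EReal.coe_mul, ← EReal.coe_mul, ← EReal.coe_add, EReal.coe_eq_coe_iff]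
    field_simp
    ring
  | top => exact (hM rfl).elim

/-- **The current `(c/d) dd^c log maxₖ |Fₖ|`** on `ℙᴺ(ℂ)`: for `K ≥ 1` non-zero homogeneous
polynomials `Fₖ` of the same degree `d ≥ 1` and `c ≥ 0`, the closed positive `(1,1)`-current with
cone potential `V = (c/d) maxₖ log |Fₖ|` and degree `c`; its singularities are algebraic analytic
singularities along `{F₁ = ⋯ = F_K = 0}`. [cite: HormanderSCV1973, Thm. 1.6.2, Cor. 1.6.6 and
§2.6; folklore] -/
def ofHomogeneousPolynomialsMax (hK : (Finset.univ : Finset (Fin K)).Nonempty)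
    (F : Fin K → MvPolynomial (Fin (N + 1)) ℂ) (d : ℕ) (hF : ∀ k, (F k).IsHomogeneous d)
    (hd : 0 < d) (hF0 : ∀ k, F k ≠ 0) (c : ℝ) (hc : 0 ≤ c) : ClosedPositiveOneOneCurrent N where
  pot v := ((c / d : ℝ) : EReal) * Finset.univ.sup' hK fun k ↦ ENNReal.log ‖eval v (F k)‖ₑ
  degree := c
  degree_nonneg := hc
  isPlurisubharmonicOn_pot :=
    ((isPlurisubharmonicOn_finset_sup' hK fun k _ ↦
      isPlurisubharmonicOn_log_enorm_mvPolynomial_eval (F k)).const_mul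
        (div_nonneg hc (Nat.cast_nonneg d))).mono (subset_univ _)
  isLogHomogeneous_pot a v ha _ := by
    show ((c / d : ℝ) : EReal) * (Finset.univ.sup' hK fun k ↦ ENNReal.log ‖eval (a • v) (F k)‖ₑ) =
      ((c / d : ℝ) : EReal) * (Finset.univ.sup' hK fun k ↦ ENNReal.log ‖eval v (F k)‖ₑ) +
        ((c * Real.log ‖a‖ : ℝ) : EReal)
    simp_rw [log_enorm_eval_smul (hF _) ha v]
    rw [sup'_const_add]
    refine const_mul_coe_add_of_ne_top hd hc _ (ne_of_lt ?_)
    exact (Finset.sup'_lt_iff hK).2 fun k _ ↦ ENNReal.log_lt_top_iff.2 enorm_lt_top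
  frequently_ne_bot v _ := by
    obtain ⟨k₀, -⟩ := hK
    refine (frequently_eval_ne_zero (hF0 k₀) v).mono fun y hy h ↦ ?_
    -- the max is `≥ log |F_{k₀} y| > -∞`, so `pot y ≠ ⊥`
    have hle : ENNReal.log ‖eval y (F k₀)‖ₑ ≤ Finset.univ.sup' ⟨k₀, Finset.mem_univ k₀⟩
        fun k ↦ ENNReal.log ‖eval y (F k)‖ₑ :=
      Finset.le_sup' (fun k ↦ ENNReal.log ‖eval y (F k)‖ₑ) (Finset.mem_univ k₀)
    rw [log_enorm_eq_coe hy] at hle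
    have hM : (Finset.univ.sup' ⟨k₀, Finset.mem_univ k₀⟩ fun k ↦ ENNReal.log ‖eval y (F k)‖ₑ) ≠ ⊥ :=
      fun hb ↦ by rw [hb, le_bot_iff] at hle; exact EReal.coe_ne_bot _ hle
    have hT : (Finset.univ.sup' ⟨k₀, Finset.mem_univ k₀⟩ fun k ↦ ENNReal.log ‖eval y (F k)‖ₑ) ≠ ⊤ :=
      ne_of_lt ((Finset.sup'_lt_iff _).2 fun k _ ↦ ENNReal.log_lt_top_iff.2 enorm_lt_top)
    obtain ⟨m, hm⟩ : ∃ m : ℝ, (Finset.univ.sup' ⟨k₀, Finset.mem_univ k₀⟩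
        fun k ↦ ENNReal.log ‖eval y (F k)‖ₑ) = m := ⟨_, (EReal.coe_toReal hT hM).symm⟩
    have h' : ((c / d : ℝ) : EReal) * (Finset.univ.sup' ⟨k₀, Finset.mem_univ k₀⟩
        fun k ↦ ENNReal.log ‖eval y (F k)‖ₑ) = ⊥ := h
    rw [hm, ← EReal.coe_mul] at h'
    exact EReal.coe_ne_bot _ h'

/-- The cone potential of `(c/d) dd^c log maxₖ |Fₖ|`. [folklore] -/
@[simp] theorem ofHomogeneousPolynomialsMax_pot (hK : (Finset.univ : Finset (Fin K)).Nonempty)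
    (F : Fin K → MvPolynomial (Fin (N + 1)) ℂ) (d : ℕ) (hF : ∀ k, (F k).IsHomogeneous d)
    (hd : 0 < d) (hF0 : ∀ k, F k ≠ 0) (c : ℝ) (hc : 0 ≤ c) (v : Fin (N + 1) → ℂ) :
    (ofHomogeneousPolynomialsMax hK F d hF hd hF0 c hc).pot v =
      ((c / d : ℝ) : EReal) * Finset.univ.sup' hK fun k ↦ ENNReal.log ‖eval v (F k)‖ₑ := rfl

/-- The degree of `(c/d) dd^c log maxₖ |Fₖ|` is `c`. [folklore] -/
@[simp] theorem degree_ofHomogeneousPolynomialsMax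
    (hK : (Finset.univ : Finset (Fin K)).Nonempty) (F : Fin K → MvPolynomial (Fin (N + 1)) ℂ)
    (d : ℕ) (hF : ∀ k, (F k).IsHomogeneous d) (hd : 0 < d) (hF0 : ∀ k, F k ≠ 0) (c : ℝ)
    (hc : 0 ≤ c) : (ofHomogeneousPolynomialsMax hK F d hF hd hF0 c hc).degree = c := rfl

/-- **Siu's theorem for the currents `(c/d) dd^c log maxₖ |Fₖ|`** (algebraic analytic
singularities): for every `c' > 0` the Lelong upper level set `E_{c'}(T) ⊆ ℙᴺ(ℂ)` is an analytic
subset — it is `{x | minₖ mult_x Fₖ ≥ c' d / c}`, of codimension `≥ 2` in general. Proof: chart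
reduction (`isAnalyticSet_lelongUpperLevelSet_of_chartPotentials`), scaling of Lelong numbers,
and Siu's theorem for maxima of polynomial logarithms on `ℂᴺ`
(`isAnalyticSet_lelongUpperLevelSet_finset_sup'_log_enorm_eval`); `ℙ⁰` is a point.
[cite: Siu1974, Main Theorem] -/
theorem isAnalyticSet_lelongUpperLevelSet_ofHomogeneousPolynomialsMax
    (hK : (Finset.univ : Finset (Fin K)).Nonempty) (F : Fin K → MvPolynomial (Fin (N + 1)) ℂ)
    (d : ℕ) (hF : ∀ k, (F k).IsHomogeneous d) (hd : 0 < d) (hF0 : ∀ k, F k ≠ 0) {c : ℝ}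
    (hc : 0 ≤ c) {c' : ℝ} (hc' : 0 < c') :
    Literature.Geometry.Kaehler.IsAnalyticSet 𝓘(ℂ, Fin N → ℂ)
      ((ofHomogeneousPolynomialsMax hK F d hF hd hF0 c hc).lelongUpperLevelSet c') := by
  rcases Nat.eq_zero_or_pos N with hN | hN
  · subst hN
    haveI := subsingleton_projectivization_fin_one
    exact isAnalyticSet_of_subsingleton _ _
  · haveI : Nontrivial (Fin N → ℂ) := by
      haveI : Nonempty (Fin N) := ⟨⟨0, hN⟩⟩
      infer_instance
    refine (ofHomogeneousPolynomialsMax hK F d hF hd hF0 c hc).isAnalyticSet_lelongUpperLevelSet_of_chartPotentials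
      hN fun i ↦ ?_
    set g : Fin K → MvPolynomial (Fin N) ℂ := fun k ↦
      aeval (Fin.insertNth i (1 : MvPolynomial (Fin N) ℂ) X) (F k) with hg
    have hg0 : ∀ k, g k ≠ 0 := fun k ↦ aeval_insertNth_ne_zero (hF k) (hF0 k) i
    have hfun : (fun w' : Fin N → ℂ ↦
        (ofHomogeneousPolynomialsMax hK F d hF hd hF0 c hc).pot (Fin.insertNth i 1 w')) =
        fun w' ↦ ((c / d : ℝ) : EReal) *
          Finset.univ.sup' hK fun k ↦ ENNReal.log ‖eval w' (g k)‖ₑ := by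
      funext w'
      rw [ofHomogeneousPolynomialsMax_pot]
      congr 1
      refine Finset.sup'_congr hK rfl fun k _ ↦ ?_
      rw [hg]
      simp only
      rw [eval_aeval_insertNth]
    rw [hfun]
    rcases hc.eq_or_lt with rfl | hcpos
    · -- `c = 0`: the chart potential is `≡ 0`
      have h0 : (fun w' : Fin N → ℂ ↦ (((0 : ℝ) / d : ℝ) : EReal) *
          Finset.univ.sup' hK fun k ↦ ENNReal.log ‖eval w' (g k)‖ₑ) = fun _ ↦ (0 : EReal) := by
        funext w'; simp
      rw [h0]
      have hempty : {w : Fin N → ℂ | c' ≤ Pluripotential.lelongNumber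
          (fun _ : Fin N → ℂ ↦ (0 : EReal)) w} = ∅ := by
        ext w
        simp only [mem_setOf_eq, mem_empty_iff_false, iff_false, not_le]
        rw [lelongNumber_zero_fun]
        exact hc'
      rw [hempty]
      exact Literature.Geometry.Kaehler.isAnalyticSet_empty
    · have hcd : 0 < c / d := div_pos hcpos (Nat.cast_pos.2 hd)
      have hset : {w : Fin N → ℂ | c' ≤ Pluripotential.lelongNumber (fun w' : Fin N → ℂ ↦
          ((c / d : ℝ) : EReal) * Finset.univ.sup' hK fun k ↦ ENNReal.log ‖eval w' (g k)‖ₑ) w} =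
          {w : Fin N → ℂ | c' / (c / d) ≤ Pluripotential.lelongNumber (fun w' : Fin N → ℂ ↦
            Finset.univ.sup' hK fun k ↦ ENNReal.log ‖eval w' (g k)‖ₑ) w} := by
        ext w
        rw [mem_setOf_eq, mem_setOf_eq, lelongNumber_const_mul hcd, div_le_iff₀ hcd, mul_comm]
      rw [hset]
      exact isAnalyticSet_lelongUpperLevelSet_finset_sup'_log_enorm_eval hK g hg0 hN _

end ClosedPositiveOneOneCurrent

end Literature.Analysis.Pluripotential

end
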